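import Summits.CriticalPhenomena.Ising3D.Control2DIsingRecursion
import Mathlib.Tactic
import HarnessLib

/-!
# The 2D Ising witness, III: the two coefficient sequences `A_j`, `B_j`
(cell `pub-ising3x`, seat controls-1 gen 37; NON-VACUITY of the 2D control's `A2D′` classes at
`Δ_σ = 1/8` by the Ising datum, step 3 — CONTROL-ONLY)

HONEST FRAMING: lottery ticket; floor = tightest certified 3D Ising CFT bounds; no exact-solution
claim without a proof. CONTROL-ONLY (`d = 2`); nothing numerical is asserted here.

The two `𝓑`-closed block families of the Ising four-point function and their coefficient sequences,
DEFINED by the three-term recursion of `Control2DIsingRecursion` (there is no closed form):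

* the identity (vacuum-module) family `h_j = 2j` (`k_0 = 1, k_4, k_8, …`), coefficients
  `isingA = (1, 1/64, 9/40960, 25/3670016, 15527/(2²⁷·3·11·13), …)` — `isingIdFamily`;
* the `ε`-module family `h_j = 1/2 + 2j` (`k_1, k_5, k_9, …`), coefficients
  `isingB = (1/2, 0, 2⁻¹⁵, 1/(5·2¹⁷), 1125/(7·2³¹), …)` — `isingEpsFamily` (the resonant bottom rows:
  `B_1 = 0` is FORCED, `B_2 = 2⁻¹⁵` comes from `8 𝓑 k_1 = -(9/1024) x² k_5`).

`A_1 = 1/64 = (1/8)²/(2·(1/2))` is the stress-tensor coefficient at the Ward value for `c = 1/2`, and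
`B_0²/2 = 1/8` the `ε` coefficient (`λ²_{σσε} = 1/4` in the normalisation `λ² = 2p`). Positivity of all
`A_j, B_j` is `Control2DIsingPositivity`; the identification `Σ_j A_j k_{4j} = f₁`, `Σ_j B_j k_{4j+1} = f₂`
is `Control2DIsingTaylor` + `Control2DIsingChiral`. Finite algebra only; values pre-checked in exact
arithmetic (they agree with the triangular solve of the expansion to order 60).

References: A. A. Belavin, A. M. Polyakov, A. B. Zamolodchikov, Nucl. Phys. B 241 (1984) 333, App. E
[cite: BelavinPolyakovZamolodchikov1984, App. E]. Tree: `threeTermSeq`, `IsingFamily`, `blockRes_three_term`,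
`blockRes_three_term_zero`, `blockRes_three_term_half`.
-/

namespace Summit.CriticalPhenomena.Ising3D.Control2D

open Finset
open Literature.MathematicalPhysics.QuantumFieldTheory.ConformalBootstrap3D

/-! ### The identity family `h_j = 2j` -/

/-- `U_j = M₊(2j)`. [cite: BelavinPolyakovZamolodchikov1984, App. E] -/
noncomputable def isingIdU (j : ℕ) : ℝ := isingMplus (2 * j)
/-- `Z_j = M₀(2j)`. [cite: BelavinPolyakovZamolodchikov1984, App. E] -/
noncomputable def isingIdZ (j : ℕ) : ℝ := isingMzero (2 * j)
/-- `D_j = M₋(2j)`. [cite: BelavinPolyakovZamolodchikov1984, App. E] -/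
noncomputable def isingIdD (j : ℕ) : ℝ := isingMminus (2 * j)

/-- **The vacuum-module quasi-primary coefficients of `⟨σσσσ⟩`**: `A_j`, the coefficient of `k_{4j}` in
the `c = 1/2` identity Virasoro block `f₁ = (1-x)^{-1/8}(√(1+√x)+√(1-√x))/2`, defined by the three-term
recursion from `A_0 = 1`. [cite: BelavinPolyakovZamolodchikov1984, App. E] -/
noncomputable def isingA : ℕ → ℝ := threeTermSeq isingIdU isingIdZ isingIdD 1

/-- `D_j = 8j(4j-1) > 0` for `j ≥ 1`. [folklore] -/
theorem isingIdD_pos {j : ℕ} (hj : 1 ≤ j) : 0 < isingIdD j := by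
  unfold isingIdD isingMminus
  have : (1 : ℝ) ≤ j := by exact_mod_cast hj
  nlinarith

/-- **The identity family is a `𝓑`-closed family with rows solved by `isingA`.**
[cite: BelavinPolyakovZamolodchikov1984, App. E] -/
theorem isingIdFamily : IsingFamily 0 isingIdU isingIdZ isingIdD isingA where
  D_zero := by simp [isingIdD]
  three_term := by
    intro j M
    rw [zero_add]
    rcases Nat.eq_zero_or_pos j with hj | hj
    · subst hj
      simp only [Nat.cast_zero, mul_zero, isingIdU, isingIdZ, isingIdD, isingMplus_zero, isingMminus_zero,
        zero_mul, zero_add, add_zero]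
      exact blockRes_three_term_zero M
    · have hh : (2 : ℝ) ≤ 2 * (j : ℝ) := by
        have : (1 : ℝ) ≤ j := by exact_mod_cast hj
        linarith
      exact blockRes_three_term hh M
  row_zero := threeTermSeq_row_zero _ _ _ _ (isingIdD_pos le_rfl).ne'
  row := fun j => threeTermSeq_row _ _ _ _ (isingIdD_pos (by omega)).ne'

/-- `A_0 = 1`. [folklore] -/
@[simp] theorem isingA_zero : isingA 0 = 1 := rfl

/-- `A_1 = 1/64 = (1/8)²/(2 · (1/2))`: the stress-tensor coefficient, the Ward value at `c = 1/2`.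
[cite: BelavinPolyakovZamolodchikov1984, §5] -/
theorem isingA_one : isingA 1 = 1 / 64 := by
  rw [isingA, threeTermSeq_one]
  norm_num [isingIdZ, isingIdD, isingMzero, isingMminus]

/-- `A_2 = 9/40960` (the single quasi-primary at level 4 of the vacuum module). [folklore] -/
theorem isingA_two : isingA 2 = 9 / 40960 := by
  rw [isingA, threeTermSeq_succ_succ, ← isingA, isingA_one, isingA_zero]
  norm_num [isingIdU, isingIdZ, isingIdD, isingMplus, isingMzero, isingMminus]

/-- `A_3 = 25/3670016`. [folklore] -/
theorem isingA_three : isingA 3 = 25 / 3670016 := by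
  rw [isingA, show (3 : ℕ) = 1 + 2 from rfl, threeTermSeq_succ_succ, ← isingA, isingA_two, isingA_one]
  norm_num [isingIdU, isingIdZ, isingIdD, isingMplus, isingMzero, isingMminus]

/-- The recursion step of `A` in ratio form: `A_{j+2} = a_j A_{j+1} - b_j A_j`,
`a_j = -Z_{j+1}/D_{j+2}`, `b_j = U_j/D_{j+2}`. [folklore] -/
theorem isingA_succ_succ (j : ℕ) :
    isingA (j + 2) = (-isingIdZ (j + 1) / isingIdD (j + 2)) * isingA (j + 1)
      - (isingIdU j / isingIdD (j + 2)) * isingA j := by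
  rw [isingA, threeTermSeq_succ_succ]
  have := (isingIdD_pos (by omega : 1 ≤ j + 2)).ne'
  field_simp
  ring

/-! ### The `ε` family `h_j = 1/2 + 2j` -/

/-- `U_j = M₊(1/2 + 2j)` for `j ≥ 1`; the resonant bottom value `U_0 = -9/1024`.
[cite: BelavinPolyakovZamolodchikov1984, App. E] -/
noncomputable def isingEpU (j : ℕ) : ℝ := if j = 0 then -9 / 1024 else isingMplus (1 / 2 + 2 * j)
/-- `Z_j = M₀(1/2 + 2j)` for `j ≥ 1`; `Z_0 = 0` (no `k_1` term in `𝓑 k_1`).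
[cite: BelavinPolyakovZamolodchikov1984, App. E] -/
noncomputable def isingEpZ (j : ℕ) : ℝ := if j = 0 then 0 else isingMzero (1 / 2 + 2 * j)
/-- `D_j = M₋(1/2 + 2j)` (`D_0 = 0`). [cite: BelavinPolyakovZamolodchikov1984, App. E] -/
noncomputable def isingEpD (j : ℕ) : ℝ := isingMminus (1 / 2 + 2 * j)

/-- **The `ε`-module quasi-primary coefficients of `⟨σσσσ⟩`**: `B_j`, the coefficient of `k_{4j+1}` in
the `c = 1/2` Virasoro block `f₂ = (1-x)^{-1/8}(√(1+√x)-√(1-√x))/2`, defined by the three-term recursion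
from `B_0 = 1/2`. [cite: BelavinPolyakovZamolodchikov1984, App. E] -/
noncomputable def isingB : ℕ → ℝ := threeTermSeq isingEpU isingEpZ isingEpD (1 / 2)

/-- `D_j = (2+8j)·4j > 0` for `j ≥ 1`. [folklore] -/
theorem isingEpD_pos {j : ℕ} (hj : 1 ≤ j) : 0 < isingEpD j := by
  unfold isingEpD isingMminus
  have : (1 : ℝ) ≤ j := by exact_mod_cast hj
  nlinarith

/-- **The `ε` family is a `𝓑`-closed family with rows solved by `isingB`.**
[cite: BelavinPolyakovZamolodchikov1984, App. E] -/
theorem isingEpsFamily : IsingFamily (1 / 2) isingEpU isingEpZ isingEpD isingB where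
  D_zero := by norm_num [isingEpD, isingMminus]
  three_term := by
    intro j M
    rcases Nat.eq_zero_or_pos j with hj | hj
    · subst hj
      have hD : isingEpD 0 = 0 := by norm_num [isingEpD, isingMminus]
      simp only [Nat.cast_zero, mul_zero, add_zero, isingEpU, isingEpZ, hD, if_true, zero_mul, add_zero]
      rw [show (1 / 2 : ℝ) + 2 = 5 / 2 by norm_num, blockRes_three_term_half M]
      ring
    · have hh : (2 : ℝ) ≤ 1 / 2 + 2 * (j : ℝ) := by
        have : (1 : ℝ) ≤ j := by exact_mod_cast hj
        linarith
      simp only [isingEpU, isingEpZ, isingEpD, if_neg hj.ne']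
      exact blockRes_three_term hh M
  row_zero := threeTermSeq_row_zero _ _ _ _ (isingEpD_pos le_rfl).ne'
  row := fun j => threeTermSeq_row _ _ _ _ (isingEpD_pos (by omega)).ne'

/-- `B_0 = 1/2` (so `p_ε = B_0²/2 = 1/8`, `λ²_{σσε} = 2 p_ε = 1/4`). [cite: BelavinPolyakovZamolodchikov1984, §5] -/
@[simp] theorem isingB_zero : isingB 0 = 1 / 2 := rfl

/-- `B_1 = 0`: NO quasi-primary at level 2 of the `ε` module (the level-2 null vector of `φ_{1,2}`),
forced by the resonant bottom row. [folklore] -/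
theorem isingB_one : isingB 1 = 0 := by
  rw [isingB, threeTermSeq_one]
  simp [isingEpZ]

/-- `B_2 = 2⁻¹⁵` (the quasi-primary at level 4 of the `ε` module). [folklore] -/
theorem isingB_two : isingB 2 = 1 / 32768 := by
  rw [isingB, threeTermSeq_succ_succ, ← isingB, isingB_one, isingB_zero]
  norm_num [isingEpU, isingEpZ, isingEpD, isingMminus]

/-- `B_3 = 1/655360 = 1/(5·2¹⁷)`. [folklore] -/
theorem isingB_three : isingB 3 = 1 / 655360 := by
  rw [isingB, show (3 : ℕ) = 1 + 2 from rfl, threeTermSeq_succ_succ, ← isingB, isingB_two, isingB_one]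
  norm_num [isingEpU, isingEpZ, isingEpD, isingMplus, isingMzero, isingMminus]

/-- The recursion step of `B` in ratio form (`j ≥ 1`, away from the resonant rows):
`B_{j+2} = a_j B_{j+1} - b_j B_j`. [folklore] -/
theorem isingB_succ_succ (j : ℕ) :
    isingB (j + 2) = (-isingEpZ (j + 1) / isingEpD (j + 2)) * isingB (j + 1)
      - (isingEpU j / isingEpD (j + 2)) * isingB j := by
  rw [isingB, threeTermSeq_succ_succ]
  have := (isingEpD_pos (by omega : 1 ≤ j + 2)).ne'
  field_simp
  ring

end Summit.CriticalPhenomena.Ising3D.Control2D
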